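import Literature.AnabelianGeometry.AbsoluteAnabelian.AbsTopIProp410Sub
import Literature.AnabelianGeometry.SemiGraphs.TemperedCurveGroupLevelDataNonVacuity2
import HarnessLib

/-!
# [AbsTopI] Def 4.2 (iii)(c) / Prop 4.10: the interface `AbsTopI.Prop410.DeCuspidalization` is
# inhabited at the free profinite model — a §4(iii) NON-VACUITY witness (abc-iut-w5-d197, gen 2)

S. Mochizuki, *Topics in absolute anabelian geometry I: generalities*, J. Math. Sci. Univ. Tokyo 19
(2012) [AbsTopI], Def 4.2 (i)(c) p. 49 / (iii)(c) p. 50 ("de-cuspidalization": "a surjection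
`Πⱼ ↠ Πⱼ₊₁` … whose kernel is topologically normally generated by the inertia group of a cusp") as
typed by abc-iut-L4-t13 in `AbsTopIProp410Sub.lean` over abc-iut-L3's §6 interface `TemperedCurve p`:
the record `AbsTopI.Prop410.DeCuspidalization X Y` (fields `f`, `fHat`, compatibilities, `fHat`
surjective, a `k`-rational CUSP `x`, and the KERNEL CLAUSE
`Ker f̂ = closure (normalClosure (I_x))`).  The row read ZERO producers in the L4 inhabitation census
v2 (05:58Z).  This PROOF-ONLY file (no `def`/`instance`/`structure`) records ONE inhabitant, with
every field PROVED, at the FREE PROFINITE MODEL of abc-iut-w5-d040 / abc-iut-w5-d218: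

* `X`: base field `ℚ_p` (`K = ⊥`), `Π^tp_X := G_{ℚ_p} × F̂₂` (compact, so `Π̂_X = Π^tp_X`, `toHat = id`),
  one closed point `x`, a CUSP, with `D_x = G_{ℚ_p} × îa(Ẑ)` and `I_x = 1 × îa(Ẑ) ≃ₜ* Ẑ`, where
  `îa : Ẑ → F̂₂` completes `k ↦ a^k` for the first free generator `a`;
* `Y`: `Π^tp_Y := G_{ℚ_p} × Ẑ`, no closed points recorded;
* `f = f̂ := id × ê_b`, `ê_b : F̂₂ → Ẑ` the completed exponent sum in the second generator `b`
  (so `f` "forgets the cusp `a`": `F̂₂ ↠ (F₂/⟨⟨a⟩⟩)^∧ = Ẑ`).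

The kernel clause is the one piece of mathematics: `Ker(id × ê_b)` is the CLOSED NORMAL SUBGROUP
GENERATED BY `I_x`.  "⊇" because `I_x ≤ Ker` (`ê_b ∘ îa = 1`) and kernels are closed and normal; "⊆"
because the quotient `Q := Π/N` by that closed normal subgroup `N` is Hausdorff and the continuous map
`y ↦ [(y₁, îb (ê_b y₂))]` agrees with the projection `Π → Q` on the dense subgroup `G_{ℚ_p} × η(F₂)` —
for `u ∈ F₂` with `σ_b`-exponent `k`, `b^{-k} u` lies in the normal closure of `a` in `F₂` (the
quotient `F₂/⟨⟨a⟩⟩` is generated by the class of `b`, `FreeGroup.ext_hom`), so `(1, η(b^{-k}u)) ∈ N` —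
hence everywhere (`DenseRange.equalizer`); at `y ∈ Ker f̂` this reads `[y] = [1]`, i.e. `y ∈ N`.

HONEST LABEL: a direct-product model (`G_{ℚ_p} × F̂₂`, no relation between the factors), not the
tempered fundamental group of a hyperbolic curve (none is constructed in the tree); the witness shows
the typed record — including its kernel clause — is satisfiable with a genuine `G_{ℚ_p}`, a genuine
free profinite `Δ`, a cusp with inertia `≅ Ẑ`, and a genuinely computed kernel.  No side taken on
[IUTchIII] Cor 3.12; a witness is consistency evidence, not an endorsement; typed ≠ proved.
-/

namespace Literature.AnabelianGeometry.AbsoluteAnabelian.AbsTopI.Prop410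

open _root_.Topology _root_.Filter _root_.Set _root_.Function
open Literature.AnabelianGeometry.SemiGraphs
open Literature.IUT.HodgeTheaters (profiniteCompletion toCompletion toCompletion_int_injective)
open Literature.AlgebraicGeometry.Frobenioids (IsSlimGroup)

/-- **[AbsTopI] Def 4.2 (iii)(c) p. 50 — a de-cuspidalization datum EXISTS (free profinite model).**
There are `X Y : TemperedCurve p` over `ℚ_p` with `Π^tp_X = G_{ℚ_p} × F̂₂`, `Π^tp_Y = G_{ℚ_p} × Ẑ`,
`X` having a cusp, and an inhabitant of `DeCuspidalization X Y` (`f = f̂ = id × ê_b`, kernel clause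
proved: `Ker f̂` is the closed normal subgroup generated by the inertia `1 × îa(Ẑ)` of the cusp).
Honest label: direct-product model, not `π₁` of a hyperbolic curve. [cite: MochizukiAbsTopI2012, Def 4.2 (iii) p.50] -/
theorem DeCuspidalization.exists_freeProfiniteModel (p : ℕ) [Fact p.Prime] :
    ∃ X Y : TemperedCurve p,
      Nonempty (DeCuspidalization X Y) ∧ X.K = ⊥ ∧ Y.K = ⊥ ∧
      X.PiTemp = (GQp p × profiniteCompletion (FreeGroup (Fin 2))) ∧
      Y.PiTemp = (GQp p × profiniteCompletion (Multiplicative ℤ)) ∧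
      (∃ x : X.Pt, X.IsCusp x) ∧ IsEmpty Y.Pt := by
  classical
  haveI : IsGalois ℚ_[p] (AlgebraicClosure ℚ_[p]) := {}
  haveI : T2Space (GQp p) := krullTopology_t2
  -- the profinite data (abc-iut-w5-d218's toolkit, as in abc-iut-w5-d040's §6 witness)
  let P : ProfiniteGrp.{0} := profiniteCompletion (FreeGroup (Fin 2))
  let Zh : ProfiniteGrp.{0} := profiniteCompletion (Multiplicative ℤ)
  let η : FreeGroup (Fin 2) →* P := toCompletion (FreeGroup (Fin 2))
  let ι : Multiplicative ℤ →* Zh := toCompletion (Multiplicative ℤ)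
  let a : FreeGroup (Fin 2) := FreeGroup.of 0
  let b : FreeGroup (Fin 2) := FreeGroup.of 1
  let σa : FreeGroup (Fin 2) →* Multiplicative ℤ :=
    FreeGroup.lift fun j => if j = (0 : Fin 2) then Multiplicative.ofAdd (1 : ℤ) else 1
  let σb : FreeGroup (Fin 2) →* Multiplicative ℤ :=
    FreeGroup.lift fun j => if j = (1 : Fin 2) then Multiplicative.ofAdd (1 : ℤ) else 1
  have hσaa : σa a = Multiplicative.ofAdd 1 := by simp [σa, a]
  have hσba : σb a = 1 := by simp [σb, a]
  have hσbb : σb b = Multiplicative.ofAdd 1 := by simp [σb, b]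
  let e : P →ₜ* Zh := (ProfiniteGrp.ProfiniteCompletion.lift (GrpCat.ofHom (ι.comp σa))).hom
  let êb : P →ₜ* Zh := (ProfiniteGrp.ProfiniteCompletion.lift (GrpCat.ofHom (ι.comp σb))).hom
  let îa : Zh →ₜ* P :=
    (ProfiniteGrp.ProfiniteCompletion.lift (GrpCat.ofHom (η.comp (zpowersHom _ a)))).hom
  let îb : Zh →ₜ* P :=
    (ProfiniteGrp.ProfiniteCompletion.lift (GrpCat.ofHom (η.comp (zpowersHom _ b)))).hom
  have he : ∀ g, e (η g) = ι (σa g) := fun g => lift_hom_toCompletion Zh (ι.comp σa) g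
  have hêb : ∀ g, êb (η g) = ι (σb g) := fun g => lift_hom_toCompletion Zh (ι.comp σb) g
  have hîa : ∀ k : ℤ, îa (ι (Multiplicative.ofAdd k)) = η (a ^ k) := fun k => by
    rw [lift_hom_toCompletion P (η.comp (zpowersHom _ a))]
    simp [zpowersHom_apply]
  have hîb : ∀ k : ℤ, îb (ι (Multiplicative.ofAdd k)) = η (b ^ k) := fun k => by
    rw [lift_hom_toCompletion P (η.comp (zpowersHom _ b))]
    simp [zpowersHom_apply]
  have heîa : ∀ t, e (îa t) = t := TemperedFibreProduct.apply_apply_eq_self_of a σa hσaa e îa he hîa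
  have hêbîb : ∀ t, êb (îb t) = t := TemperedFibreProduct.apply_apply_eq_self_of b σb hσbb êb îb hêb hîb
  have hêbîa : ∀ t, êb (îa t) = 1 := TemperedFibreProduct.apply_apply_eq_one_of a σb hσba êb îa hêb hîa
  -- `X`: `Π := G_{ℚ_p} × F̂₂`, inertia `I := îa(Ẑ)`, decomposition group `D := G_{ℚ_p} × I`
  let I : Subgroup P := îa.toMonoidHom.range
  have hIclosed : IsClosed (I : Set P) := by
    have : (I : Set P) = Set.range îa := by ext x; simp [I]
    rw [this]; exact (isCompact_range îa.continuous).isClosed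
  let D : Subgroup (GQp p × P) := (⊤ : Subgroup (GQp p)).prod I
  have hDmem : ∀ x : GQp p × P, x ∈ D ↔ x.2 ∈ I := fun x => by simp [D, Subgroup.mem_prod]
  have hDclosed : IsClosed (D : Set (GQp p × P)) := by
    have : (D : Set (GQp p × P)) = Prod.snd ⁻¹' (I : Set P) := by
      ext x; exact hDmem x
    rw [this]; exact hIclosed.preimage continuous_snd
  let fstH : GQp p × P →ₜ* GQp p := ContinuousMonoidHom.fst _ _
  have hfstD : fstH '' (D : Set (GQp p × P)) = Set.univ :=
    Set.eq_univ_of_forall fun g => ⟨(g, 1), (hDmem _).2 I.one_mem, rfl⟩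
  have hinertia : Nonempty (↥(D ⊓ fstH.toMonoidHom.ker) ≃ₜ* ZHat) := by
    refine ⟨{ toFun := fun x => e x.1.2
              invFun := fun t => ⟨(1, îa t), (hDmem _).2 ⟨t, rfl⟩, (MonoidHom.mem_ker).2 rfl⟩
              left_inv := fun x => ?_
              right_inv := fun t => heîa t
              map_mul' := fun x y => by
                change e ((x : GQp p × P) * y).2 = e (x : GQp p × P).2 * e (y : GQp p × P).2
                rw [Prod.snd_mul, map_mul]
              continuous_toFun := e.continuous.comp (continuous_snd.comp continuous_subtype_val)
              continuous_invFun := (continuous_const.prodMk îa.continuous).subtype_mk _ }⟩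
    obtain ⟨⟨g, z⟩, hgz⟩ := x
    have hg : g = 1 := (MonoidHom.mem_ker).1 (Subgroup.mem_inf.1 hgz).2
    obtain ⟨u, hu⟩ : z ∈ I := (hDmem _).1 (Subgroup.mem_inf.1 hgz).1
    apply Subtype.ext
    change ((1 : GQp p), îa (e z)) = (g, z)
    rw [hg, ← hu]
    exact Prod.ext rfl (congrArg îa (heîa u))
  let X : TemperedCurve p :=
    { K := ⊥
      finiteDimensional_K := inferInstance
      PiTemp := GQp p × P
      aug := fstH
      range_aug := by
        rw [IntermediateField.fixingSubgroup_bot]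
        exact MonoidHom.range_eq_top.mpr Prod.fst_surjective
      PiHat := GQp p × P
      toHat := ContinuousMonoidHom.id _
      isProfiniteCompletion_toHat := isProfiniteCompletion_id _
      toHat_injective := Function.injective_id
      augHat := fstH
      augHat_comp := fun _ => rfl
      Pt := Unit
      IsCusp := fun _ => True
      decomp := fun _ => D
      isClosed_decomp := fun _ => hDclosed
      isOpen_aug_decomp := fun _ => by
        change IsOpen (fstH '' (D : Set (GQp p × P)))
        rw [hfstD]; exact isOpen_univ
      inertia_eq_bot := fun _ h => (h trivial).elim
      inertia_equiv_zHat := fun _ _ => hinertia }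
  -- `Y`: `Π := G_{ℚ_p} × Ẑ`, no points
  let fstZ : GQp p × Zh →ₜ* GQp p := ContinuousMonoidHom.fst _ _
  let Y : TemperedCurve p :=
    { K := ⊥
      finiteDimensional_K := inferInstance
      PiTemp := GQp p × Zh
      aug := fstZ
      range_aug := by
        rw [IntermediateField.fixingSubgroup_bot]
        exact MonoidHom.range_eq_top.mpr Prod.fst_surjective
      PiHat := GQp p × Zh
      toHat := ContinuousMonoidHom.id _
      isProfiniteCompletion_toHat := isProfiniteCompletion_id _
      toHat_injective := Function.injective_id
      augHat := fstZ
      augHat_comp := fun _ => rfl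
      Pt := PEmpty
      IsCusp := fun x => x.elim
      decomp := fun x => x.elim
      isClosed_decomp := fun x => x.elim
      isOpen_aug_decomp := fun x => x.elim
      inertia_eq_bot := fun x => x.elim
      inertia_equiv_zHat := fun x => x.elim }
  -- the de-cuspidalization `f = f̂ := id × ê_b`
  let f : GQp p × P →ₜ* GQp p × Zh := (ContinuousMonoidHom.id (GQp p)).prodMap êb
  have hf : ∀ y : GQp p × P, f y = (y.1, êb y.2) := fun _ => rfl
  -- the generating set of the kernel clause: the inertia subgroup `I_x = D ∩ Ker(pr₁) = 1 × îa(Ẑ)`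
  have hinertia_eq : (X.inertia ()).map X.toHat.toMonoidHom = D ⊓ fstH.toMonoidHom.ker := by
    ext y
    constructor
    · rintro ⟨z, hz, rfl⟩; exact hz
    · intro hy; exact ⟨y, hy, rfl⟩
  have hSmem : ∀ y : GQp p × P, y ∈ D ⊓ fstH.toMonoidHom.ker ↔ y.2 ∈ I ∧ y.1 = 1 := fun y => by
    rw [Subgroup.mem_inf, hDmem, MonoidHom.mem_ker]; rfl
  -- notation for the closed normal closure `N`
  have hker : f.toMonoidHom.ker =
      (Subgroup.normalClosure ((D ⊓ fstH.toMonoidHom.ker : Subgroup (GQp p × P)) :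
        Set (GQp p × P))).topologicalClosure := by
    set S : Set (GQp p × P) := ((D ⊓ fstH.toMonoidHom.ker : Subgroup (GQp p × P)) : Set (GQp p × P))
      with hS
    set N : Subgroup (GQp p × P) := (Subgroup.normalClosure S).topologicalClosure with hN
    haveI hNn : N.Normal := Subgroup.is_normal_topologicalClosure _
    have hNclosed : IsClosed (N : Set (GQp p × P)) := Subgroup.isClosed_topologicalClosure _
    apply le_antisymm
    · -- `Ker f̂ ≤ N`: the retraction argument in the Hausdorff quotient `Π / N`
      haveI : IsClosed (N : Set (GQp p × P)) := hNclosed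
      -- `(1, η a) ∈ S ⊆ N`
      have haS : ((1 : GQp p), η a) ∈ S := by
        rw [hS]
        refine (hSmem _).2 ⟨⟨ι (Multiplicative.ofAdd 1), ?_⟩, rfl⟩
        change îa (ι (Multiplicative.ofAdd 1)) = η a
        rw [hîa, zpow_one]
      have haN : ((1 : GQp p), η a) ∈ N :=
        Subgroup.le_topologicalClosure _ (Subgroup.subset_normalClosure haS)
      -- `σ_b v = 0 ⇒ (1, η v) ∈ N` (via `v ∈ ⟨⟨a⟩⟩ ≤ F₂`: `F₂/⟨⟨a⟩⟩` is generated by the class of `b`)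
      have hvN : ∀ v : FreeGroup (Fin 2), σb v = 1 → ((1 : GQp p), η v) ∈ N := by
        intro v hv
        let Ncl : Subgroup (FreeGroup (Fin 2)) := Subgroup.normalClosure ({a} : Set (FreeGroup (Fin 2)))
        have hqa : (QuotientGroup.mk' Ncl) a = 1 :=
          (QuotientGroup.eq_one_iff a).mpr (Subgroup.subset_normalClosure (Set.mem_singleton a))
        have hhom : QuotientGroup.mk' Ncl =
            ((zpowersHom (FreeGroup (Fin 2) ⧸ Ncl) (QuotientGroup.mk' Ncl b) :
              Multiplicative ℤ →* FreeGroup (Fin 2) ⧸ Ncl)).comp σb := by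
          refine FreeGroup.ext_hom _ _ fun i => ?_
          match i with
          | 0 =>
            change (QuotientGroup.mk' Ncl) a = _
            rw [hqa, MonoidHom.comp_apply, zpowersHom_apply]
            change (1 : FreeGroup (Fin 2) ⧸ Ncl) = _ ^ (Multiplicative.toAdd (σb a))
            rw [hσba]; simp
          | 1 =>
            change (QuotientGroup.mk' Ncl) b = _
            rw [MonoidHom.comp_apply, zpowersHom_apply]
            change _ = _ ^ (Multiplicative.toAdd (σb b))
            rw [hσbb]; simp
        have hqv : (QuotientGroup.mk' Ncl) v = 1 := by
          rw [hhom, MonoidHom.comp_apply, zpowersHom_apply, hv]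
          simp
        have hvmem : v ∈ Ncl := (QuotientGroup.eq_one_iff v).mp hqv
        let ψ : FreeGroup (Fin 2) →* GQp p × P := (MonoidHom.inr (GQp p) P).comp η
        have hle : Ncl ≤ N.comap ψ := by
          refine Subgroup.normalClosure_le_normal ?_
          intro w hw
          rw [Set.mem_singleton_iff] at hw
          subst hw
          exact haN
        exact hle hvmem
      -- the projection `π` and the retraction-composite `ρ` agree on the dense subgroup `G × η(F₂)`
      let π : GQp p × P → (GQp p × P) ⧸ N := QuotientGroup.mk
      let ρ : GQp p × P → (GQp p × P) ⧸ N := fun y => π (y.1, îb (êb y.2))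
      have hπ : Continuous π := QuotientGroup.continuous_mk
      have hρ : Continuous ρ :=
        hπ.comp (continuous_fst.prodMk (îb.continuous.comp (êb.continuous.comp continuous_snd)))
      have hdense : DenseRange (Prod.map (id : GQp p → GQp p) η) :=
        denseRange_id.prodMap (ProfiniteGrp.ProfiniteCompletion.denseRange (GrpCat.of (FreeGroup (Fin 2))))
      have hagree : ρ ∘ Prod.map id η = π ∘ Prod.map id η := by
        funext gu
        obtain ⟨g, u⟩ := gu
        change π (g, îb (êb (η u))) = π (g, η u)
        have hk : êb (η u) = ι (Multiplicative.ofAdd (Multiplicative.toAdd (σb u))) := by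
          rw [hêb]; rfl
        rw [hk, hîb]
        refine QuotientGroup.eq.mpr ?_
        have hprod : ((g, η (b ^ Multiplicative.toAdd (σb u)))⁻¹ * (g, η u) : GQp p × P) =
            (1, η ((b ^ Multiplicative.toAdd (σb u))⁻¹ * u)) := by
          refine Prod.ext ?_ ?_
          · simp
          · simp [map_mul, map_inv]
        rw [hprod]
        refine hvN _ ?_
        rw [map_mul, map_inv, map_zpow, hσbb, ← ofAdd_zsmul, smul_eq_mul, mul_one, ofAdd_toAdd,
          inv_mul_cancel]
      have hρπ : ρ = π := hdense.equalizer hρ hπ hagree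
      intro y hy
      have hy1 : f y = 1 := (MonoidHom.mem_ker).1 hy
      rw [hf] at hy1
      have h1 : y.1 = 1 := congrArg Prod.fst hy1
      have h2 : êb y.2 = 1 := congrArg Prod.snd hy1
      have hπy : π y = 1 := by
        rw [← congrFun hρπ y]
        change π (y.1, îb (êb y.2)) = 1
        rw [h1, h2, map_one]
        rfl
      exact (QuotientGroup.eq_one_iff y).mp hπy
    · -- `N ≤ Ker f̂`: `S ⊆ Ker f̂`, kernels are closed and normal
      refine Subgroup.topologicalClosure_minimal _ (Subgroup.normalClosure_le_normal ?_) ?_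
      · intro y hy
        rw [hS] at hy
        obtain ⟨⟨t, ht⟩, hy1⟩ := (hSmem y).1 hy
        rw [SetLike.mem_coe, MonoidHom.mem_ker]
        change f y = 1
        rw [hf, hy1, ← ht]
        change ((1 : GQp p), êb (îa t)) = 1
        rw [hêbîa]; rfl
      · have : ((f.toMonoidHom.ker : Subgroup (GQp p × P)) : Set (GQp p × P)) = f ⁻¹' {1} := by
          ext y; simp [MonoidHom.mem_ker]
        rw [this]
        exact isClosed_singleton.preimage f.continuous
  have d : DeCuspidalization X Y :=
    { f := f
      fHat := f
      toHat_comp := fun _ => rfl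
      aug_comp := fun _ => rfl
      fHat_surjective := fun z => ⟨(z.1, îb z.2), Prod.ext rfl (hêbîb z.2)⟩
      x := ()
      isCusp := trivial
      rational := by
        change fstH '' (D : Set (GQp p × P)) = Set.range fstH
        rw [hfstD]
        exact (Set.range_eq_univ.mpr Prod.fst_surjective).symm
      ker_fHat := by rw [hinertia_eq]; exact hker }
  exact ⟨X, Y, ⟨d⟩, rfl, rfl, rfl, rfl, ⟨(), trivial⟩, inferInstanceAs (IsEmpty PEmpty)⟩

end Literature.AnabelianGeometry.AbsoluteAnabelian.AbsTopI.Prop410
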